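import Literature.Analysis.FluidPDE.ConstantinDirectionDissipationProofs
import Summits.NavierStokesRegularity.NavierStokesRegularity.Theorems.SlicedKelvinPlanarFluxAPrioriFoldPointwise
import Literature.Analysis.FluidPDE.FourierL2Convolution

/-!
# Crux `SlicedKelvin.PlanarFluxAPriori` (stmt-NavierStokesRegularity-15600), line `Sketch`
# (card halfspace-apex-identity): the time-integrated, fixed-`ε` apex budget

Support file (`--supports stmt-NavierStokesRegularity-15600`), a CALIBRATION LEMMA for the open stub
`stub_slabApexBound` of line `Sketch` (`Cruxes/PlanarFluxAPriori/Lines/Sketch.lean`). The open stub asks for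
`sup_t liminf_{ε→0⁺}` of the slab apex functional `τ^ε_n(S,t) = ∫_S (ε²/√(f²+ε²)³)|Df[ω]| dx`,
`ω = curl u(t)`, `f = ⟪ω, n⟫`. What the ENERGY CLASS gives instead is recorded here: granted the
Constantin-type level-set dissipation budget for `f = ω·n` (the registered stub
`stub_apexLevelSetDissipation`, taken as a hypothesis verbatim:
`νε ∫₀ᵀ∫ (ε²/√(f²+ε²)³)² ‖Df‖² ≤ (3π/8)(‖ω₀‖₁ + √2 (2ν)⁻¹ ‖u₀‖₂²)`), Cauchy–Schwarz in space–time with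
`|Df[ω]| ≤ ‖Df‖ ‖ω‖`, `‖ω‖² ≤ 2|∇u|²_F` and the Leray–Hopf dissipation bound `ν∫₀ᵀ∫|∇u|²_F ≤ ½‖u₀‖₂²` give

  `ν² ε (∫₀ᵀ τ^ε_n(ℝ³,t) dt)² ≤ (3π/8)(‖ω₀‖₁ + √2 (2ν)⁻¹‖u₀‖₂²) ‖u₀‖₂²`,

i.e. the regularised TOTAL apex functional is a priori `L¹` in time at cost `ε^{-1/2}`. The stub itself needs
`sup_t` and `ε → 0⁺` (on slabs): the gap is exactly the removal of the `ε^{-1/2}` (regularity of the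
Gelfand–Leray function of `ω·n` at level `0`) and of the time integration (Constantin, CMP 129 (1990), §3,
Thm 3.2 bounds level-AVERAGED, time-averaged areas of vorticity level sets by the same multiplier method).
-/

noncomputable section

namespace Summit.NavierStokesRegularity.NavierStokesRegularity.Theorems.SlicedKelvinPlanarFluxAPriori

-- the summit and its single sub-problem share the name (CONVENTIONS §1), as in every Theorems file
set_option linter.dupNamespace false

open MeasureTheory Set Filter Function Literature.Analysis.FluidPDE
open scoped ENNReal NNReal Topology RealInnerProductSpace

/-- **Time-integrated, fixed-`ε` apex budget (calibration lemma for `stub_slabApexBound`).** Granted the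
level-set dissipation budget for `f = ω·n` (hypothesis = the registered stub `stub_apexLevelSetDissipation`,
verbatim), along every classical Leray–Hopf solution from a rapidly decaying datum, for every frame `R`
(`n = R e₂`) and every `ε > 0`:
`ν²ε (∫₀ᵀ∫ (ε²/√(f²+ε²)³)|Df[curl u]| dx dt)² ≤ (3π/8)(‖curl u₀‖₁ + √2(2ν)⁻¹‖u₀‖₂²)·‖u₀‖₂²`
(Cauchy–Schwarz in space–time, `|Df[ω]| ≤ ‖Df‖‖ω‖`, `‖ω‖² ≤ 2|∇u|²_F`, `ν∫∫|∇u|²_F ≤ ½‖u₀‖₂²`). -/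
theorem stub_apexBudgetTimeIntegrated :
    (∀ (ν T : ℝ), 0 < ν → 0 < T → ∀ (u : ℝ → EuclideanSpace ℝ (Fin 3) → EuclideanSpace ℝ (Fin 3)) (p : ℝ → EuclideanSpace ℝ (Fin 3) → ℝ), Literature.Analysis.FluidPDE.IsClassicalNSSolutionOn (Set.Ico 0 T) ν 0 u p → Literature.Analysis.FluidPDE.IsLerayHopfOn T ν 0 (u 0) u → Literature.Analysis.FluidPDE.HasRapidSpatialDecay (u 0) → ∀ (R : EuclideanSpace ℝ (Fin 3) ≃ₗᵢ[ℝ] EuclideanSpace ℝ (Fin 3)) (ε : ℝ), 0 < ε → ENNReal.ofReal (ν * ε) * ∫⁻ q in Set.Ioo 0 T ×ˢ (Set.univ : Set (EuclideanSpace ℝ (Fin 3))), ENNReal.ofReal ((ε ^ 2 / Real.sqrt (inner ℝ (Literature.Analysis.FluidPDE.curl (u q.1) q.2) (R (EuclideanSpace.single 2 1)) ^ 2 + ε ^ 2) ^ 3) ^ 2 * ‖fderiv ℝ (fun z => inner ℝ (Literature.Analysis.FluidPDE.curl (u q.1) z) (R (EuclideanSpace.single 2 1))) q.2‖ ^ 2)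 ≤ ENNReal.ofReal (3 * Real.pi / 8) * ((∫⁻ x, ‖Literature.Analysis.FluidPDE.curl (u 0) x‖ₑ) + ENNReal.ofReal (Real.sqrt 2) * (ENNReal.ofReal (2 * ν))⁻¹ * ∫⁻ x, ‖u 0 x‖ₑ ^ 2)) →
    ∀ (ν T : ℝ), 0 < ν → 0 < T → ∀ (u : ℝ → EuclideanSpace ℝ (Fin 3) → EuclideanSpace ℝ (Fin 3))
      (p : ℝ → EuclideanSpace ℝ (Fin 3) → ℝ),
      Literature.Analysis.FluidPDE.IsClassicalNSSolutionOn (Set.Ico 0 T) ν 0 u p →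
      Literature.Analysis.FluidPDE.IsLerayHopfOn T ν 0 (u 0) u →
      Literature.Analysis.FluidPDE.HasRapidSpatialDecay (u 0) →
      ∀ (R : EuclideanSpace ℝ (Fin 3) ≃ₗᵢ[ℝ] EuclideanSpace ℝ (Fin 3)) (ε : ℝ), 0 < ε →
      ENNReal.ofReal (ν ^ 2 * ε) *
        (∫⁻ q in Set.Ioo 0 T ×ˢ (Set.univ : Set (EuclideanSpace ℝ (Fin 3))),
          ENNReal.ofReal (ε ^ 2 / Real.sqrt (inner ℝ (Literature.Analysis.FluidPDE.curl (u q.1) q.2)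
            (R (EuclideanSpace.single 2 1)) ^ 2 + ε ^ 2) ^ 3 *
            |fderiv ℝ (fun z => inner ℝ (Literature.Analysis.FluidPDE.curl (u q.1) z)
              (R (EuclideanSpace.single 2 1))) q.2 (Literature.Analysis.FluidPDE.curl (u q.1) q.2)|)) ^ 2 ≤
      ENNReal.ofReal (3 * Real.pi / 8) * ((∫⁻ x, ‖Literature.Analysis.FluidPDE.curl (u 0) x‖ₑ) +
        ENNReal.ofReal (Real.sqrt 2) * (ENNReal.ofReal (2 * ν))⁻¹ * ∫⁻ x, ‖u 0 x‖ₑ ^ 2) *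
        ∫⁻ x, ‖u 0 x‖ₑ ^ 2 := by
  intro hLS ν T hν hT u p hcl hLH hdec R ε hε
  -- notation-free abbreviations
  set n : EuclideanSpace ℝ (Fin 3) := R (EuclideanSpace.single 2 1) with hn
  set μ : Measure (ℝ × EuclideanSpace ℝ (Fin 3)) :=
    volume.restrict (Set.Ioo 0 T ×ˢ (Set.univ : Set (EuclideanSpace ℝ (Fin 3)))) with hμ
  set ρ : ℝ × EuclideanSpace ℝ (Fin 3) → ℝ := fun q =>
    ε ^ 2 / Real.sqrt (inner ℝ (curl (u q.1) q.2) n ^ 2 + ε ^ 2) ^ 3 with hρ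
  set L : ℝ × EuclideanSpace ℝ (Fin 3) → (EuclideanSpace ℝ (Fin 3) →L[ℝ] ℝ) := fun q =>
    fderiv ℝ (fun z => inner ℝ (curl (u q.1) z) n) q.2 with hL
  set a : ℝ × EuclideanSpace ℝ (Fin 3) → ℝ≥0∞ := fun q => ENNReal.ofReal (ρ q * ‖L q‖) with ha
  set b : ℝ × EuclideanSpace ℝ (Fin 3) → ℝ≥0∞ := fun q => ‖curl (u q.1) q.2‖ₑ with hb
  have hρ0 : ∀ q, 0 ≤ ρ q := fun q => by
    rw [hρ]
    positivity
  -- pointwise domination of the apex density by `a * b`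
  have hpt : ∀ q, ENNReal.ofReal (ρ q * |L q (curl (u q.1) q.2)|) ≤ a q * b q := by
    intro q
    simp only [ha, hb]
    rw [← ofReal_norm (curl (u q.1) q.2), ← ENNReal.ofReal_mul (mul_nonneg (hρ0 q) (norm_nonneg _)),
      mul_assoc]
    refine ENNReal.ofReal_le_ofReal (mul_le_mul_of_nonneg_left ?_ (hρ0 q))
    rw [← Real.norm_eq_abs]
    exact (L q).le_opNorm _
  -- joint continuity on the closed-open slab, hence measurability
  have hU : UniqueDiffOn ℝ (Set.Ico 0 T) := uniqueDiffOn_Ico 0 T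
  have hw : IsSmoothSpaceTimeOn (Set.Ico 0 T) (vorticity u) := hcl.isSmoothSpaceTimeOn_vorticity hU
  have hwc : ContinuousOn (uncurry (vorticity u)) (Set.Ico 0 T ×ˢ univ) := hw.continuousOn
  have hDwc : ContinuousOn (fun z : ℝ × EuclideanSpace ℝ (Fin 3) => fderiv ℝ (vorticity u z.1) z.2)
      (Set.Ico 0 T ×ˢ univ) := hw.continuousOn_fderiv_slice hU
  have hLeq : ∀ q ∈ Set.Ico 0 T ×ˢ (univ : Set (EuclideanSpace ℝ (Fin 3))),
      L q = (innerSL ℝ n).comp (fderiv ℝ (vorticity u q.1) q.2) := by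
    intro q hq
    have hd : DifferentiableAt ℝ (vorticity u q.1) q.2 :=
      ((hw.contDiff_slice hq.1).differentiable (by simp)).differentiableAt
    rw [hL]
    exact (hasFDerivAt_inner_const hd.hasFDerivAt n).fderiv
  have hLc : ContinuousOn L (Set.Ico 0 T ×ˢ univ) := by
    refine ContinuousOn.congr ?_ hLeq
    exact ((ContinuousLinearMap.compL ℝ (EuclideanSpace ℝ (Fin 3)) (EuclideanSpace ℝ (Fin 3)) ℝ
      (innerSL ℝ n)).continuous).comp_continuousOn hDwc
  have hρc : ContinuousOn ρ (Set.Ico 0 T ×ˢ univ) := by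
    have h1 : ContinuousOn (fun q : ℝ × EuclideanSpace ℝ (Fin 3) => inner ℝ (curl (u q.1) q.2) n)
        (Set.Ico 0 T ×ˢ univ) := hwc.inner continuousOn_const
    refine continuousOn_const.div (((h1.pow 2).add continuousOn_const).sqrt.pow 3) fun q _ => ?_
    exact pow_ne_zero 3 (Real.sqrt_pos.2 (by positivity)).ne'
  have hsub : Set.Ioo 0 T ×ˢ (univ : Set (EuclideanSpace ℝ (Fin 3))) ⊆ Set.Ico 0 T ×ˢ univ :=
    prod_mono Ioo_subset_Ico_self Subset.rfl
  have hmeas : MeasurableSet (Set.Ioo 0 T ×ˢ (univ : Set (EuclideanSpace ℝ (Fin 3)))) :=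
    measurableSet_Ioo.prod MeasurableSet.univ
  have ha_m : AEMeasurable a μ :=
    (((hρc.mul hLc.norm).mono hsub).aemeasurable hmeas).ennreal_ofReal
  have hb_m : AEMeasurable b μ :=
    ((continuous_enorm.comp_continuousOn (hwc.mono hsub)).aemeasurable hmeas)
  -- Cauchy–Schwarz
  have hCS : (∫⁻ q, ENNReal.ofReal (ρ q * |L q (curl (u q.1) q.2)|) ∂μ) ^ 2 ≤
      (∫⁻ q, a q ^ 2 ∂μ) * ∫⁻ q, b q ^ 2 ∂μ :=
    (pow_le_pow_left' (lintegral_mono fun q => hpt q) 2).trans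
      (Literature.Analysis.FluidPDE.FourierNS.sq_lintegral_mul_le μ ha_m hb_m)
  -- the first factor: the level-set dissipation budget
  have hA : ENNReal.ofReal (ν * ε) * ∫⁻ q, a q ^ 2 ∂μ ≤
      ENNReal.ofReal (3 * Real.pi / 8) * ((∫⁻ x, ‖curl (u 0) x‖ₑ) +
        ENNReal.ofReal (Real.sqrt 2) * (ENNReal.ofReal (2 * ν))⁻¹ * ∫⁻ x, ‖u 0 x‖ₑ ^ 2) := by
    have h := hLS ν T hν hT u p hcl hLH hdec R ε hε
    have heq : ∫⁻ q, a q ^ 2 ∂μ = ∫⁻ q in Set.Ioo 0 T ×ˢ (Set.univ : Set (EuclideanSpace ℝ (Fin 3))),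
        ENNReal.ofReal ((ε ^ 2 / Real.sqrt (inner ℝ (curl (u q.1) q.2) n ^ 2 + ε ^ 2) ^ 3) ^ 2 *
          ‖fderiv ℝ (fun z => inner ℝ (curl (u q.1) z) n) q.2‖ ^ 2) := by
      refine lintegral_congr fun q => ?_
      rw [ha, ← ENNReal.ofReal_pow (mul_nonneg (hρ0 q) (norm_nonneg _)), mul_pow]
    rw [heq]
    exact h
  -- the second factor: enstrophy ≤ 2 × dissipation ≤ ‖u₀‖₂²/ν
  obtain ⟨hDfin, hDE⟩ := IsLerayHopfOn.lintegral_frobeniusNormSq_fderiv_of_classical hcl hLH hT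
  set D : ℝ≥0∞ := ∫⁻ τ in Set.Ioo 0 T, ∫⁻ x, ENNReal.ofReal (frobeniusNormSq (fderiv ℝ (u τ) x)) with hD
  have hB : ENNReal.ofReal ν * ∫⁻ q, b q ^ 2 ∂μ ≤ ∫⁻ x, ‖u 0 x‖ₑ ^ 2 := by
    -- pointwise `‖ω‖² ≤ 2 |∇u|²_F`
    have hpt2 : ∀ q, b q ^ 2 ≤ 2 * ENNReal.ofReal (frobeniusNormSq (fderiv ℝ (u q.1) q.2)) := by
      intro q
      have key : ENNReal.ofReal (‖curl (u q.1) q.2‖ ^ 2) ≤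
          ENNReal.ofReal (2 * frobeniusNormSq (fderiv ℝ (u q.1) q.2)) :=
        ENNReal.ofReal_le_ofReal (norm_curl_sq_le_two_mul_frobeniusNormSq (u q.1) q.2)
      have e : ENNReal.ofReal (2 * frobeniusNormSq (fderiv ℝ (u q.1) q.2)) =
          2 * ENNReal.ofReal (frobeniusNormSq (fderiv ℝ (u q.1) q.2)) := by
        rw [ENNReal.ofReal_mul (by norm_num), ENNReal.ofReal_ofNat]
      simp only [hb]
      rw [← ofReal_norm, ← ENNReal.ofReal_pow (norm_nonneg _)]
      exact key.trans_eq e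
    -- Tonelli: the space–time integral of `|∇u|²_F` is the iterated one, `D`
    have hFc : ContinuousOn (fun z : ℝ × EuclideanSpace ℝ (Fin 3) =>
        frobeniusNormSq (fderiv ℝ (u z.1) z.2)) (Set.Ico 0 T ×ˢ univ) := by
      have h := (hcl.smooth_velocity.fderiv_slice hU).continuousOn
      unfold frobeniusNormSq
      exact continuousOn_finsetSum _ fun i _ => ((h.clm_apply continuousOn_const).norm).pow 2
    have hFm : AEMeasurable (fun z : ℝ × EuclideanSpace ℝ (Fin 3) =>
        ENNReal.ofReal (frobeniusNormSq (fderiv ℝ (u z.1) z.2))) μ :=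
      ((hFc.mono hsub).aemeasurable hmeas).ennreal_ofReal
    have hμ' : μ = ((volume : Measure ℝ).restrict (Set.Ioo 0 T)).prod
        (volume : Measure (EuclideanSpace ℝ (Fin 3))) := by
      rw [hμ, Measure.volume_eq_prod, Measure.restrict_prod_eq_prod_univ]
    have hTon : ∫⁻ q, ENNReal.ofReal (frobeniusNormSq (fderiv ℝ (u q.1) q.2)) ∂μ = D := by
      have hFm' : AEMeasurable (fun z : ℝ × EuclideanSpace ℝ (Fin 3) =>
          ENNReal.ofReal (frobeniusNormSq (fderiv ℝ (u z.1) z.2)))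
          (((volume : Measure ℝ).restrict (Set.Ioo 0 T)).prod
            (volume : Measure (EuclideanSpace ℝ (Fin 3)))) := by
        rwa [← hμ']
      rw [hμ', lintegral_prod _ hFm']
    -- the energy inequality
    have hu₀ : Integrable fun x => ‖u 0 x‖ ^ 2 :=
      (hLH.memLp 0 ⟨le_rfl, hT.le⟩).integrable_norm_pow two_ne_zero
    have h1 : 2 * ν * D.toReal ≤ ∫ x, ‖u 0 x‖ ^ 2 := by
      rw [VectorCalculus.kineticEnergy] at hDE
      linarith
    calc ENNReal.ofReal ν * ∫⁻ q, b q ^ 2 ∂μ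
        ≤ ENNReal.ofReal ν * ∫⁻ q, 2 * ENNReal.ofReal (frobeniusNormSq (fderiv ℝ (u q.1) q.2)) ∂μ := by
          exact mul_le_mul' le_rfl (lintegral_mono hpt2)
      _ = ENNReal.ofReal (2 * ν) * D := by
          rw [lintegral_const_mul'' _ hFm, hTon, ← mul_assoc, ENNReal.ofReal_mul (by norm_num : (0:ℝ) ≤ 2),
            ENNReal.ofReal_ofNat, mul_comm (ENNReal.ofReal ν) 2]
      _ = ENNReal.ofReal (2 * ν * D.toReal) := by
          rw [ENNReal.ofReal_mul (by positivity : (0:ℝ) ≤ 2 * ν), ENNReal.ofReal_toReal hDfin]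
      _ ≤ ENNReal.ofReal (∫ x, ‖u 0 x‖ ^ 2) := ENNReal.ofReal_le_ofReal h1
      _ = ∫⁻ x, ‖u 0 x‖ₑ ^ 2 := ofReal_integral_sq_norm hu₀
  -- combine
  calc ENNReal.ofReal (ν ^ 2 * ε) *
        (∫⁻ q in Set.Ioo 0 T ×ˢ (Set.univ : Set (EuclideanSpace ℝ (Fin 3))),
          ENNReal.ofReal (ρ q * |L q (curl (u q.1) q.2)|)) ^ 2
      ≤ ENNReal.ofReal (ν ^ 2 * ε) * ((∫⁻ q, a q ^ 2 ∂μ) * ∫⁻ q, b q ^ 2 ∂μ) := by gcongr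
    _ = (ENNReal.ofReal (ν * ε) * ∫⁻ q, a q ^ 2 ∂μ) * (ENNReal.ofReal ν * ∫⁻ q, b q ^ 2 ∂μ) := by
        rw [show ν ^ 2 * ε = (ν * ε) * ν by ring, ENNReal.ofReal_mul (by positivity)]
        ring
    _ ≤ _ := mul_le_mul' hA hB

end Summit.NavierStokesRegularity.NavierStokesRegularity.Theorems.SlicedKelvinPlanarFluxAPriori

end
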